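import Mathlib
import Summits.AtomisticToContinuum.FouriersLaw.Theorems.EmbeddedDrudeMourreDrudeDissolutionSupBoundPrep
import Summits.AtomisticToContinuum.FouriersLaw.Theorems.EmbeddedDrudeMourreDrudeDissolutionSupBoundCurve
import Summits.AtomisticToContinuum.FouriersLaw.Theorems.EmbeddedDrudeMourreDrudeDissolutionSupBoundCorner
import Summits.AtomisticToContinuum.FouriersLaw.Theorems.EmbeddedDrudeMourreDrudeDissolutionFluxPointwiseTwo
import Summits.AtomisticToContinuum.FouriersLaw.Theorems.EmbeddedDrudeMourreDrudeDissolutionWeightStructure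
import Summits.AtomisticToContinuum.FouriersLaw.Theorems.EmbeddedDrudeMourreDrudeDissolutionFloorGlobal
import Summits.AtomisticToContinuum.FouriersLaw.Theorems.EmbeddedDrudeMourreDrudeDissolutionStubExcursionSecondDifferenceCornerFloorD
import Summits.AtomisticToContinuum.FouriersLaw.Theorems.EmbeddedDrudeMourreDrudeDissolutionStubExcursionSecondDifferenceWCornerBounds
import HarnessLib

/-!
# The per-point `η⁻²` sup bound of the double gradient flux (item (C6) of stub B1b″)
(crux `EmbeddedDrudeMourre.DrudeDissolution`, item stmt-AtomisticToContinuum-12593; `--supports` file for the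
registered sub-goal `supBound_pointwise` of stub B1b″ `stub_excursionSecondDifference` of line
`kinetic-polymer-gas-on-the-time-axis`; closes nothing; lead c13 (process B), 2026-08-17)

WHAT. `supBound_pointwise`: for the concrete pair resonance `Ω`, the excursion weight `W` of a sine polynomial
profile, the gradient data `D, X₁, X₂, X₃` of `cube_secondDiff_of_cutoffFamily`, and constants `aΘ, bΘ ≥ 0`, there
is `K ≥ 0` such that for every `0 < η ≤ 1` and every `C²` cutoff `Θ` with values in `[0,1]`, vanishing identically
near the points where one of the five arguments `ρₖ` is `< η²`, and with `|∂Θ| ≤ aΘ/η`, `|∂²Θ| ≤ bΘ/η²` along the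
standard frame: at EVERY point `p`, with `L = Σⱼ∂ⱼ(WΘXⱼ)`,
`|∂₁(L X₁) + ∂₂(L X₂) + ∂₃(L X₃)|(p) ≤ K/η²` — the sup hypothesis of `cube_secondDiff_of_cutoffFamily`.

HOW. Off the support: `flux_zero_of_eventuallyEq_zero`. On it (`ρₖ(p) ≥ η²` for all `k`): `flux_pointwise_bound`
with the sizes of `G = WΘ` (`product_g_bounds`), the Hessian structure `resonance_structure_bounds`, and either the
corner floor `corner_floor_dminus/dplus` + corner weight bounds `weight_corner_bounds` + `supBound_corner_algebra`
(near a corner lattice), or the Morse–Bott floor `resonance_gradient_floor` + `weight_structure_bounds` +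
`supBound_curve_algebra` (elsewhere).
-/

noncomputable section

open scoped Topology
open Filter Set

namespace Summit.AtomisticToContinuum.FouriersLaw.Theorems.DrudeDissolution.KineticPolymerGasOnTheTimeAxis

open Literature.MathematicalPhysics.KineticTheory
open Literature.MathematicalPhysics.KineticTheory.PhononBoltzmann

/-- **Registered sub-goal `supBound_pointwise` of stub B1b″ (item (C6)).** See the module docstring. [folklore] -/
theorem supBound_pointwise :
    ∀ ω₂ a b : ℝ, 0 < ω₂ → ∀ (M : ℕ) (c : Fin M → ℝ) (f : ℝ → ℝ) (A S₁ S₂ W D X₁ X₂ X₃ : ℝ × ℝ × ℝ → ℝ),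
      (∀ k, f k = ∑ i, c i * Real.sin (((i : ℕ) + 1 : ℕ) * k)) →
      (∀ p : ℝ × ℝ × ℝ, S₁ p = Real.sin ((p.2.1 - p.1) / 2)) →
      (∀ p : ℝ × ℝ × ℝ, S₂ p = Real.sin ((p.2.1 - p.2.2) / 2)) →
      (∀ p : ℝ × ℝ × ℝ, A p =
        8 * ((dispersion ω₂ p.1 * dispersion ω₂ p.2.2 +
                dispersion ω₂ p.2.1 * dispersion ω₂ (p.1 + p.2.2 - p.2.1) + 2 * (ω₂ + 2)) *
              Real.cos ((p.1 + p.2.2) / 2) -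
            4 * Real.cos ((p.2.1 - p.1) / 2) * Real.cos ((p.2.2 - p.2.1) / 2)) /
          ((dispersion ω₂ p.1 + dispersion ω₂ p.2.2 + dispersion ω₂ p.2.1 + dispersion ω₂ (p.1 + p.2.2 - p.2.1)) *
            (dispersion ω₂ p.1 * dispersion ω₂ p.2.2 +
              dispersion ω₂ p.2.1 * dispersion ω₂ (p.1 + p.2.2 - p.2.1)))) →
      (∀ p : ℝ × ℝ × ℝ, W p = vertex a b p.1 p.2.2 p.2.1 ^ 2 /
          (dispersion ω₂ p.1 * dispersion ω₂ p.2.2 * dispersion ω₂ p.2.1 * dispersion ω₂ (p.1 + p.2.2 - p.2.1)) ^ 2 *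
        (f p.1 + f p.2.2 - f p.2.1 - f (p.1 + p.2.2 - p.2.1)) ^ 2) →
      (∀ q, D q = (fderiv ℝ (fun r : ℝ × ℝ × ℝ => resonanceFn ω₂ r.1 r.2.2 r.2.1) q (1, 0, 0)) ^ 2 +
          (fderiv ℝ (fun r : ℝ × ℝ × ℝ => resonanceFn ω₂ r.1 r.2.2 r.2.1) q (0, 1, 0)) ^ 2 +
          (fderiv ℝ (fun r : ℝ × ℝ × ℝ => resonanceFn ω₂ r.1 r.2.2 r.2.1) q (0, 0, 1)) ^ 2) →
      (∀ q, X₁ q = fderiv ℝ (fun r : ℝ × ℝ × ℝ => resonanceFn ω₂ r.1 r.2.2 r.2.1) q (1, 0, 0) / D q) →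
      (∀ q, X₂ q = fderiv ℝ (fun r : ℝ × ℝ × ℝ => resonanceFn ω₂ r.1 r.2.2 r.2.1) q (0, 1, 0) / D q) →
      (∀ q, X₃ q = fderiv ℝ (fun r : ℝ × ℝ × ℝ => resonanceFn ω₂ r.1 r.2.2 r.2.1) q (0, 0, 1) / D q) →
      ∀ aΘ bΘ : ℝ, 0 ≤ aΘ → 0 ≤ bΘ → ∃ K : ℝ, 0 ≤ K ∧ ∀ η : ℝ, 0 < η → η ≤ 1 → ∀ Θ LG : ℝ × ℝ × ℝ → ℝ,
        ContDiff ℝ 2 Θ → (∀ p, 0 ≤ Θ p ∧ Θ p ≤ 1) →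
        (∀ p : ℝ × ℝ × ℝ, (S₁ p ^ 2 + A p ^ 2 < η ^ 2 ∨ S₂ p ^ 2 + A p ^ 2 < η ^ 2 ∨ S₁ p ^ 2 + S₂ p ^ 2 < η ^ 2 ∨
            (1 - Real.cos p.1) + (1 - Real.cos p.2.2) + (1 + Real.cos p.2.1) < η ^ 2 ∨
            (1 + Real.cos p.1) + (1 + Real.cos p.2.2) + (1 - Real.cos p.2.1) < η ^ 2) → Θ =ᶠ[𝓝 p] 0) →
        (∀ (p : ℝ × ℝ × ℝ) (i j : Fin 3),
            |fderiv ℝ Θ p ((![((1 : ℝ), (0 : ℝ), (0 : ℝ)), (0, 1, 0), (0, 0, 1)] : Fin 3 → ℝ × ℝ × ℝ) i)| ≤ aΘ / η ∧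
            |fderiv ℝ (fun q => fderiv ℝ Θ q ((![((1 : ℝ), (0 : ℝ), (0 : ℝ)), (0, 1, 0), (0, 0, 1)] : Fin 3 → ℝ × ℝ × ℝ) i))
                p ((![((1 : ℝ), (0 : ℝ), (0 : ℝ)), (0, 1, 0), (0, 0, 1)] : Fin 3 → ℝ × ℝ × ℝ) j)| ≤ bΘ / η ^ 2) →
        (∀ q, LG q = fderiv ℝ (fun r => W r * Θ r * X₁ r) q (1, 0, 0) +
          fderiv ℝ (fun r => W r * Θ r * X₂ r) q (0, 1, 0) + fderiv ℝ (fun r => W r * Θ r * X₃ r) q (0, 0, 1)) →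
        ∀ p : ℝ × ℝ × ℝ, |fderiv ℝ (fun q => LG q * X₁ q) p (1, 0, 0) + fderiv ℝ (fun q => LG q * X₂ q) p (0, 1, 0) +
          fderiv ℝ (fun q => LG q * X₃ q) p (0, 0, 1)| ≤ K / η ^ 2 := by
  intro ω₂ a b hω M c f A S₁ S₂ W D X₁ X₂ X₃ hf hS₁ hS₂ hA hW hD hX₁ hX₂ hX₃ aΘ bΘ haΘ hbΘ
  set Ω : ℝ × ℝ × ℝ → ℝ := fun r => resonanceFn ω₂ r.1 r.2.2 r.2.1 with hΩ
  set E : Fin 3 → ℝ × ℝ × ℝ := ![((1 : ℝ), (0 : ℝ), (0 : ℝ)), (0, 1, 0), (0, 0, 1)] with hEdef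
  have hE0 : E 0 = (1, 0, 0) := rfl
  have hE1 : E 1 = (0, 1, 0) := rfl
  have hE2 : E 2 = (0, 0, 1) := rfl
  have hEadm : ∀ i, |(E i).1| ≤ 1 ∧ |(E i).2.1| ≤ 1 ∧ |(E i).2.2| ≤ 1 ∧ |(E i).2.1 - (E i).1| ≤ 1 ∧
      |(E i).2.1 - (E i).2.2| ≤ 1 := stdFrame_admissible
  have hEadm' : ∀ i, |(E i).2.1 - (E i).1| ≤ 1 ∧ |(E i).2.1 - (E i).2.2| ≤ 1 := fun i =>
    ⟨(hEadm i).2.2.2.1, (hEadm i).2.2.2.2⟩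
  -- η-independent constants
  obtain ⟨CA, hCA0, hCA⟩ := resonance_A_bounds hω hA E
  obtain ⟨Cn, Ct, hCn0, hCt0, hstr⟩ := resonance_structure_bounds ω₂ hω A S₁ S₂ hS₁ hS₂ hA E hEadm'
  obtain ⟨CW, hCW0, hWb⟩ := weight_structure_bounds ω₂ a b hω M c f S₁ S₂ W hf hS₁ hS₂ hW E hEadm'
  obtain ⟨Cc, hCc0, hWc⟩ := weight_corner_bounds ω₂ a b hω M c f W hf hW E
  obtain ⟨r₁, c₁, hr₁, hc₁, hfl₁⟩ := corner_floor_dminus ω₂ hω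
  obtain ⟨r₂, c₂, hr₂, hc₂, hfl₂⟩ := corner_floor_dplus ω₂ hω
  obtain ⟨cF, hcF, hflF⟩ := resonance_gradient_floor ω₂ hω A S₁ S₂ hS₁ hS₂ hA (min r₁ r₂) (lt_min hr₁ hr₂)
  -- regularity of `Ω` and `W`
  have hΩ3 : ContDiff ℝ 3 Ω := resonance_contDiff_Omega hω 3
  obtain ⟨B, CB, -, hfac, hB2, -⟩ := weight_factorisation ω₂ a b hω M c f S₁ S₂ W hf hS₁ hS₂ hW E
  have hW2 : ContDiff ℝ 2 W := by
    rw [show W = fun q => (S₁ q * S₂ q) ^ 2 * B q from funext hfac]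
    exact (((resonance_contDiff_S₁ hS₁ 2).mul (resonance_contDiff_S₂ hS₂ 2)).pow 2).mul hB2
  have hW0 : ∀ p, 0 ≤ W p := fun p => by rw [hW]; positivity
  have hS₁1 : ∀ p, |S₁ p| ≤ 1 := fun p => by rw [hS₁]; exact Real.abs_sin_le_one _
  have hS₂1 : ∀ p, |S₂ p| ≤ 1 := fun p => by rw [hS₂]; exact Real.abs_sin_le_one _
  -- the three regime constants
  set c₁' := min c₁ 1 with hc₁'
  set c₂' := min c₂ 1 with hc₂'
  set c' := min cF 1 with hc'
  have hc₁'0 : 0 < c₁' := lt_min hc₁ one_pos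
  have hc₂'0 : 0 < c₂' := lt_min hc₂ one_pos
  have hc'0 : 0 < c' := lt_min hcF one_pos
  have hc₁'1 : c₁' ≤ 1 := min_le_right _ _
  have hc₂'1 : c₂' ≤ 1 := min_le_right _ _
  have hc'1 : c' ≤ 1 := min_le_right _ _
  set nC := Cn * (CA + 2) with hnC
  have hnC0 : 0 ≤ nC := by rw [hnC]; positivity
  set Km := 9 * Cc * (1 + 2 * aΘ + bΘ) / c₁' + 189 * Cc * nC * (1 + aΘ) / (c₁' * Real.sqrt c₁') +
    63 * Cc * Ct / (c₁' * Real.sqrt c₁') + 1359 * Cc * nC ^ 2 / c₁' ^ 2 with hKm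
  set Kp := 9 * Cc * (1 + 2 * aΘ + bΘ) / c₂' + 189 * Cc * nC * (1 + aΘ) / (c₂' * Real.sqrt c₂') +
    63 * Cc * Ct / (c₂' * Real.sqrt c₂') + 1359 * Cc * nC ^ 2 / c₂' ^ 2 with hKp
  set Kc := 9 * CW * (3 + 6 * aΘ + bΘ) / c' + 189 * CW * Cn * (9 + 3 * aΘ) / (c' * Real.sqrt c') +
    126 * CW * Ct / (c' * Real.sqrt c') + 12231 * CW * Cn ^ 2 / c' ^ 2 with hKc
  have hKm0 : 0 ≤ Km := by rw [hKm]; positivity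
  have hKp0 : 0 ≤ Kp := by rw [hKp]; positivity
  have hKc0 : 0 ≤ Kc := by rw [hKc]; positivity
  have hKsum : 0 ≤ Km + Kp + Kc := add_nonneg (add_nonneg hKm0 hKp0) hKc0
  refine ⟨Km + Kp + Kc, hKsum, ?_⟩
  intro η hη hη1 Θ LG hΘC hΘ01 hvan hΘd hLG p
  have hη2 : 0 < η ^ 2 := pow_pos hη 2
  -- the frame data of `flux_pointwise_bound`
  set dd : Fin 3 → (ℝ × ℝ × ℝ) → ℝ := fun i q => fderiv ℝ Ω q (E i) with hdd
  set XX : Fin 3 → (ℝ × ℝ × ℝ) → ℝ := ![X₁, X₂, X₃] with hXX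
  have hX0 : XX 0 = X₁ := rfl
  have hX1 : XX 1 = X₂ := rfl
  have hX2 : XX 2 = X₃ := rfl
  have hD' : ∀ q, D q = ∑ i, dd i q ^ 2 := fun q => by
    rw [Fin.sum_univ_three]; exact hD q
  have hXX' : ∀ i q, XX i q = dd i q / D q := by
    intro i q
    fin_cases i
    · exact hX₁ q
    · exact hX₂ q
    · exact hX₃ q
  have hLG' : ∀ q, LG q = ∑ i, fderiv ℝ (fun r => (W r * Θ r) * XX i r) q (E i) := fun q => by
    rw [Fin.sum_univ_three]; exact hLG q
  have hgoal : fderiv ℝ (fun q => LG q * X₁ q) p (1, 0, 0) + fderiv ℝ (fun q => LG q * X₂ q) p (0, 1, 0) +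
      fderiv ℝ (fun q => LG q * X₃ q) p (0, 0, 1) = ∑ i, fderiv ℝ (fun q => LG q * XX i q) p (E i) := by
    rw [Fin.sum_univ_three]; rfl
  have hGC : ContDiff ℝ 2 (fun q => W q * Θ q) := hW2.mul hΘC
  -- off the support: everything vanishes near `p`
  by_cases hoff : S₁ p ^ 2 + A p ^ 2 < η ^ 2 ∨ S₂ p ^ 2 + A p ^ 2 < η ^ 2 ∨ S₁ p ^ 2 + S₂ p ^ 2 < η ^ 2 ∨
      (1 - Real.cos p.1) + (1 - Real.cos p.2.2) + (1 + Real.cos p.2.1) < η ^ 2 ∨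
      (1 + Real.cos p.1) + (1 + Real.cos p.2.2) + (1 - Real.cos p.2.1) < η ^ 2
  · have hG0 : (fun q => W q * Θ q) =ᶠ[𝓝 p] 0 :=
      (hvan p hoff).mono fun q hq => by simp only [Pi.zero_apply] at hq ⊢; rw [hq, mul_zero]
    have hz : fderiv ℝ (fun q => LG q * X₁ q) p (1, 0, 0) + fderiv ℝ (fun q => LG q * X₂ q) p (0, 1, 0) +
        fderiv ℝ (fun q => LG q * X₃ q) p (0, 0, 1) = 0 :=
      flux_zero_of_eventuallyEq_zero (fun q => W q * Θ q) X₁ X₂ X₃ LG p hG0 hLG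
    have hK0 : 0 ≤ (Km + Kp + Kc) / η ^ 2 := div_nonneg hKsum hη2.le
    calc |fderiv ℝ (fun q => LG q * X₁ q) p (1, 0, 0) + fderiv ℝ (fun q => LG q * X₂ q) p (0, 1, 0) +
          fderiv ℝ (fun q => LG q * X₃ q) p (0, 0, 1)| = |(0 : ℝ)| := congrArg _ hz
      _ = 0 := abs_zero
      _ ≤ (Km + Kp + Kc) / η ^ 2 := hK0
  rw [hgoal]
  -- structure inputs at `p`
  have hn_curve : ∀ k j, |fderiv ℝ (dd k) p (E j)| ≤ Cn * (|S₁ p| + |S₂ p| + |A p|) := fun k j =>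
    ((hstr p k j 0).1).trans (le_of_eq (by ring))
  have hn_corner : ∀ k j, |fderiv ℝ (dd k) p (E j)| ≤ nC := fun k j => by
    refine ((hstr p k j 0).1).trans ?_
    rw [hnC]
    have h1 := hS₁1 p; have h2 := hS₂1 p; have h3 := (hCA p).1
    have : |A p| + |S₁ p| + |S₂ p| ≤ CA + 2 := by linarith
    exact mul_le_mul_of_nonneg_left this hCn0
  have ht : ∀ k i l, |fderiv ℝ (fun q => fderiv ℝ (dd k) q (E i)) p (E l)| ≤ Ct := fun k i l => (hstr p k i l).2
  -- the Θ sizes at `p`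
  have hΘ1 : ∀ i, |fderiv ℝ Θ p (E i)| ≤ aΘ / η := fun i => (hΘd p i 0).1
  have hΘ2 : ∀ i j, |fderiv ℝ (fun q => fderiv ℝ Θ q (E i)) p (E j)| ≤ bΘ / η ^ 2 := fun i j => (hΘd p i j).2
  have hfinal : ∀ {B K : ℝ}, |∑ i, fderiv ℝ (fun q => LG q * XX i q) p (E i)| ≤ B → B ≤ K / η ^ 2 →
      K ≤ Km + Kp + Kc → |∑ i, fderiv ℝ (fun q => LG q * XX i q) p (E i)| ≤ (Km + Kp + Kc) / η ^ 2 :=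
    fun h1 h2 h3 => h1.trans (h2.trans (div_le_div_of_nonneg_right h3 hη2.le))
  -- on the support
  push Not at hoff
  obtain ⟨hρ1, hρ2, hρ3, hρ4, hρ5⟩ := hoff
  by_cases hcm : (1 - Real.cos p.1) + (1 - Real.cos p.2.2) + (1 + Real.cos p.2.1) < r₁
  · -- corner regime at the minima
    set d := (1 - Real.cos p.1) + (1 - Real.cos p.2.2) + (1 + Real.cos p.2.1) with hddef
    have hd0 : 0 < d := lt_of_lt_of_le hη2 hρ4
    have hfl : c₁' * d ≤ D p := by
      have := hfl₁ p hcm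
      rw [← hddef] at this
      refine le_trans (mul_le_mul_of_nonneg_right (min_le_left _ _) hd0.le) ?_
      rw [hD]; exact this
    set m := Real.sqrt (c₁' * d) with hm
    have hm0 : 0 < m := Real.sqrt_pos.2 (by positivity)
    have hm2 : m ^ 2 ≤ D p := by rw [hm, Real.sq_sqrt (by positivity)]; exact hfl
    -- sizes of `G = WΘ`
    obtain ⟨w0, w0', w1, w1', w2⟩ : W p ≤ Cc * d ∧ True ∧ (∀ i, |fderiv ℝ W p (E i)| ≤ Cc * Real.sqrt d) ∧ True ∧
        (∀ i j, |fderiv ℝ (fun q => fderiv ℝ W q (E i)) p (E j)| ≤ Cc) :=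
      ⟨(hWc p).1, trivial, fun i => ((hWc p).2.2.1 i).1, trivial, (hWc p).2.2.2⟩
    have aW : |W p| ≤ Cc * d := by rw [abs_of_nonneg (hW0 p)]; exact w0
    have hg : ∀ i j, |W p * Θ p| ≤ Cc * d ∧ |fderiv ℝ (fun q => W q * Θ q) p (E i)| ≤ Cc * Real.sqrt d + Cc * d * (aΘ / η) ∧
        |fderiv ℝ (fun q => fderiv ℝ (fun r => W r * Θ r) q (E i)) p (E j)| ≤
          Cc + 2 * (Cc * Real.sqrt d) * (aΘ / η) + Cc * d * (bΘ / η ^ 2) := fun i j =>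
      product_g_bounds hW2 hΘC hΘ01 p (E i) (E j) aW (w1 i) (w1 j) (w2 i j) (hΘ1 i) (hΘ1 j) (hΘ2 i j)
    have hflux := flux_pointwise_bound Ω (fun q => W q * Θ q) D LG E dd XX p m nC Ct (Cc * d)
      (Cc * (Real.sqrt d + d * aΘ / η)) (Cc * (1 + 2 * Real.sqrt d * aΘ / η + d * bΘ / η ^ 2)) hΩ3 hGC
      (fun i q => rfl) hD' hXX' hLG' hm0 hm2 hn_corner ht (hg 0 0).1
      (fun i => ((hg i 0).2.1).trans (le_of_eq (by ring))) (fun i l => ((hg i l).2.2).trans (le_of_eq (by ring)))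
    have halg := supBound_corner_algebra d η c₁' Cc aΘ bΘ nC Ct hη hη1 hρ4 hc₁'0 hc₁'1 hCc0 haΘ hbΘ hnC0 hCt0
    exact hfinal hflux halg (by linarith)
  by_cases hcp : (1 + Real.cos p.1) + (1 + Real.cos p.2.2) + (1 - Real.cos p.2.1) < r₂
  · -- corner regime at the maxima
    set d := (1 + Real.cos p.1) + (1 + Real.cos p.2.2) + (1 - Real.cos p.2.1) with hddef
    have hd0 : 0 < d := lt_of_lt_of_le hη2 hρ5
    have hfl : c₂' * d ≤ D p := by
      have := hfl₂ p hcp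
      rw [← hddef] at this
      refine le_trans (mul_le_mul_of_nonneg_right (min_le_left _ _) hd0.le) ?_
      rw [hD]; exact this
    set m := Real.sqrt (c₂' * d) with hm
    have hm0 : 0 < m := Real.sqrt_pos.2 (by positivity)
    have hm2 : m ^ 2 ≤ D p := by rw [hm, Real.sq_sqrt (by positivity)]; exact hfl
    have aW : |W p| ≤ Cc * d := by rw [abs_of_nonneg (hW0 p)]; exact (hWc p).2.1
    have w1 : ∀ i, |fderiv ℝ W p (E i)| ≤ Cc * Real.sqrt d := fun i => ((hWc p).2.2.1 i).2
    have w2 : ∀ i j, |fderiv ℝ (fun q => fderiv ℝ W q (E i)) p (E j)| ≤ Cc := (hWc p).2.2.2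
    have hg : ∀ i j, |W p * Θ p| ≤ Cc * d ∧ |fderiv ℝ (fun q => W q * Θ q) p (E i)| ≤ Cc * Real.sqrt d + Cc * d * (aΘ / η) ∧
        |fderiv ℝ (fun q => fderiv ℝ (fun r => W r * Θ r) q (E i)) p (E j)| ≤
          Cc + 2 * (Cc * Real.sqrt d) * (aΘ / η) + Cc * d * (bΘ / η ^ 2) := fun i j =>
      product_g_bounds hW2 hΘC hΘ01 p (E i) (E j) aW (w1 i) (w1 j) (w2 i j) (hΘ1 i) (hΘ1 j) (hΘ2 i j)
    have hflux := flux_pointwise_bound Ω (fun q => W q * Θ q) D LG E dd XX p m nC Ct (Cc * d)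
      (Cc * (Real.sqrt d + d * aΘ / η)) (Cc * (1 + 2 * Real.sqrt d * aΘ / η + d * bΘ / η ^ 2)) hΩ3 hGC
      (fun i q => rfl) hD' hXX' hLG' hm0 hm2 hn_corner ht (hg 0 0).1
      (fun i => ((hg i 0).2.1).trans (le_of_eq (by ring))) (fun i l => ((hg i l).2.2).trans (le_of_eq (by ring)))
    have halg := supBound_corner_algebra d η c₂' Cc aΘ bΘ nC Ct hη hη1 hρ5 hc₂'0 hc₂'1 hCc0 haΘ hbΘ hnC0 hCt0
    exact hfinal hflux halg (by linarith)
  -- curve regime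
  push Not at hcm hcp
  set x := |S₁ p| with hx
  set y := |S₂ p| with hy
  set z := |A p| with hz
  have hx2 : x ^ 2 = S₁ p ^ 2 := sq_abs _
  have hy2 : y ^ 2 = S₂ p ^ 2 := sq_abs _
  have hz2 : z ^ 2 = A p ^ 2 := sq_abs _
  have hxy : η ^ 2 ≤ x ^ 2 + y ^ 2 := by rw [hx2, hy2]; exact hρ3
  have hxz : η ^ 2 ≤ x ^ 2 + z ^ 2 := by rw [hx2, hz2]; exact hρ1
  have hyz : η ^ 2 ≤ y ^ 2 + z ^ 2 := by rw [hy2, hz2]; exact hρ2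
  obtain ⟨hμ, -⟩ := supAlgebra_powerCounting x y z η (abs_nonneg _) (abs_nonneg _) (abs_nonneg _) hη hη1 hxy hxz hyz
  have hfl : c' * (z ^ 2 * x ^ 2 + z ^ 2 * y ^ 2 + x ^ 2 * y ^ 2) ≤ D p := by
    have := hflF p ((min_le_left _ _).trans hcm) ((min_le_right _ _).trans hcp)
    rw [hx2, hy2, hz2, hD]
    refine le_trans (mul_le_mul_of_nonneg_right (min_le_left _ _) (by positivity)) ?_
    refine le_trans (le_of_eq (by ring)) this
  set m := Real.sqrt (c' * (z ^ 2 * x ^ 2 + z ^ 2 * y ^ 2 + x ^ 2 * y ^ 2)) with hm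
  have hm0 : 0 < m := Real.sqrt_pos.2 (by positivity)
  have hm2 : m ^ 2 ≤ D p := by rw [hm, Real.sq_sqrt (by positivity)]; exact hfl
  -- sizes of `G = WΘ` in the curve regime
  have aW : |W p| ≤ CW * (x ^ 2 * y ^ 2) := by
    have := (hWb p 0 0).1; rwa [← hx2, ← hy2] at this
  have w1 : ∀ i, |fderiv ℝ W p (E i)| ≤ CW * (x * y * (x + y)) := fun i => by
    have := (hWb p i 0).2.1; rwa [abs_mul, ← hx, ← hy] at this
  have w2 : ∀ i j, |fderiv ℝ (fun q => fderiv ℝ W q (E i)) p (E j)| ≤ CW * (x ^ 2 + y ^ 2) := fun i j => by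
    have := (hWb p i j).2.2; rwa [← hx2, ← hy2] at this
  have hg : ∀ i j, |W p * Θ p| ≤ CW * (x ^ 2 * y ^ 2) ∧
      |fderiv ℝ (fun q => W q * Θ q) p (E i)| ≤ CW * (x * y * (x + y)) + CW * (x ^ 2 * y ^ 2) * (aΘ / η) ∧
      |fderiv ℝ (fun q => fderiv ℝ (fun r => W r * Θ r) q (E i)) p (E j)| ≤
        CW * (x ^ 2 + y ^ 2) + 2 * (CW * (x * y * (x + y))) * (aΘ / η) + CW * (x ^ 2 * y ^ 2) * (bΘ / η ^ 2) :=
    fun i j => product_g_bounds hW2 hΘC hΘ01 p (E i) (E j) aW (w1 i) (w1 j) (w2 i j) (hΘ1 i) (hΘ1 j) (hΘ2 i j)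
  have hn' : ∀ k j, |fderiv ℝ (dd k) p (E j)| ≤ Cn * (x + y + z) := fun k j => hn_curve k j
  have hflux := flux_pointwise_bound Ω (fun q => W q * Θ q) D LG E dd XX p m (Cn * (x + y + z)) Ct
    (CW * (x ^ 2 * y ^ 2)) (CW * (x * y * (x + y) + aΘ * (x ^ 2 * y ^ 2) / η))
    (CW * (x ^ 2 + y ^ 2 + 2 * aΘ * (x * y * (x + y)) / η + bΘ * (x ^ 2 * y ^ 2) / η ^ 2)) hΩ3 hGC
    (fun i q => rfl) hD' hXX' hLG' hm0 hm2 hn' ht (hg 0 0).1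
    (fun i => ((hg i 0).2.1).trans (le_of_eq (by ring))) (fun i l => ((hg i l).2.2).trans (le_of_eq (by ring)))
  have halg := supBound_curve_algebra x y z η c' CW aΘ bΘ Cn Ct (abs_nonneg _) (abs_nonneg _) (abs_nonneg _) hη hη1
    hc'0 hc'1 hCW0 haΘ hbΘ hCn0 hCt0 hxy hxz hyz
  exact hfinal hflux halg (by linarith)

end Summit.AtomisticToContinuum.FouriersLaw.Theorems.DrudeDissolution.KineticPolymerGasOnTheTimeAxis

end
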